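import Summits.CriticalPhenomena.Ising3DConformalLimit.Theses.PrecisionLaplacian
import Literature.Probability.LatticeModels.CriticalTwoPointLawDimension
import Literature.Barriers.CriticalPhenomena.TwoPointLawNotMoebius

/-!
# `MoebiusLimitOfTwoPointLaw` (crux `stmt-CriticalPhenomena-4801`): CANONICAL FORM (negative-side support)

Support file of the crux disprover (cdisprove seat, cycle 2); companion of `ReadBack.lean`. Proved here,
`sorry`-free:

* `exists_local_bound_of_hasPointwiseScalingLimit` — MODEL-BLIND: a pointwise scaling limit of ANY lattice
  family is locally bounded off the diagonals (a rescaled lattice correlator takes finitely many values near any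
  configuration, `rescaledCorrelator_bounded_on_ball`).
* `hasPointwiseScalingLimit_of_ratio_tendsto` — MODEL-BLIND: pointwise scaling limits are stable under
  renormalisations with a convergent ratio (`ρ'/ρ → μ` turns the limit `S_n` into `μ^n S_n`). (Without local
  boundedness of the limit this is false for abstract function families; lattice families get it for free.)
* `tendsto_rho_sq_mul_rpow` — under `P` with exponent `Δ`, EVERY pointwise scaling limit `(ρ, S)` of
  `criticalCorr 3` has `ρ(δ)² δ^{2Δ} → S₂(0,e₁)/c` along the FULL filter `δ → 0⁺` (the dyadic subsequence is
  `rho_sq_asymptotics_of_twoPointLaw`); `tendsto_canonical_ratio`: `δ^{-Δ}/ρ(δ) → √(c/S₂(0,e₁))`.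
* `twoPointLaw_exponent_unique` — two witnesses `(Δ₁,c₁)`, `(Δ₂,c₂)` of `P` have `Δ₁ = Δ₂`.
* `moebiusLimitOfTwoPointLaw_iff_canonical` — **canonical form**: the crux holds iff for every `(Δ, c)`
  witnessing `P`, the `δ^{-nΔ}`-renormalised critical correlators converge locally uniformly off the
  diagonals to a non-degenerate Möbius-covariant family OF DIMENSION `Δ`. The `∃ ρ ∃ Δ'` of item 1344 carry
  no freedom under item 0634: a proof must supply exactly the convergence of
  `δ^{-nΔ}⟨σ_{[x₁/δ]}⋯σ_{[xₙ/δ]}⟩_{β_c}` for all `n` along the full filter plus Möbius covariance of the limit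
  with the two-point exponent; `moebiusLimitOfTwoPointLaw_iff_canonical_at` is the one-exponent form.
-/

noncomputable section

namespace Summit.CriticalPhenomena.Ising3DConformalLimit.Theorems.MoebiusLimitOfTwoPointLaw.Negative

open Literature.Probability.LatticeModels Filter Topology
open Summit.CriticalPhenomena.Ising3DConformalLimit.Theses.PrecisionLaplacian (MoebiusLimitOfTwoPointLaw)

/-! ## §2 Canonical form of the crux: `ρ := δ^{-Δ}` with the SAME `Δ` as in `P`

Under `P` with exponent `Δ` the existential renormalisation and dimension in `Q` carry no freedom: the crux is
EQUIVALENT to "for every `(Δ, c)` witnessing the two-point law, the canonically renormalised correlators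
`δ^{-nΔ} ⟨σ_{[x₁/δ]} ⋯ σ_{[xₙ/δ]}⟩_{β_c}` converge (locally uniformly off the diagonals) to a non-degenerate
Möbius-covariant family of dimension `Δ`" (`moebiusLimitOfTwoPointLaw_iff_canonical`). Ingredients: `Δ' = Δ` (p68682);
`ρ(δ)² δ^{2Δ} → S₂(0,e₁)/c` along the FULL filter `δ → 0⁺` (`tendsto_rho_sq_mul_rpow`, new: cycle 1 had the dyadic
subsequence); and the model-blind fact that `HasPointwiseScalingLimit` is stable under renormalisations with a
convergent ratio (`hasPointwiseScalingLimit_of_ratio_tendsto`) — which needs, and gets for free for LATTICE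
families, local boundedness of the limit (a rescaled lattice correlator takes finitely many values near any
configuration). -/

section Canonical

variable {G : LatticeCorrFamily 3} {ρ ρ' : ℝ → ℝ} {S : CorrFamily 3}

/-- A rescaled LATTICE correlator at a fixed mesh `δ > 0` is bounded on every ball of configurations: the
roundings `[y/δ]` range over a finite set. -/
theorem rescaledCorrelator_bounded_on_ball (G : LatticeCorrFamily 3) (ρ : ℝ → ℝ) (n : ℕ) {δ : ℝ}
    (hδ : 0 < δ) (x : Fin n → EuclideanSpace ℝ (Fin 3)) (r : ℝ) :
    ∃ B : ℝ, ∀ y ∈ Metric.ball x r, |rescaledCorrelator G ρ n δ y| ≤ B := by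
  -- the finite box of possible roundings
  set K : Set (Fin n → Site 3) :=
    Set.pi Set.univ fun i => Set.pi Set.univ fun j =>
      Set.Icc ⌊((x i) j - r) / δ⌋ ⌈((x i) j + r) / δ⌉ with hK
  have hKfin : K.Finite :=
    Set.Finite.pi fun i => Set.Finite.pi fun j => Set.finite_Icc _ _
  have hmem : ∀ y ∈ Metric.ball x r, (fun i => latticeApprox δ (y i)) ∈ K := by
    intro y hy
    simp only [hK, Set.mem_pi, Set.mem_univ, true_implies, Set.mem_Icc, latticeApprox_apply]
    intro i j
    have hyi : dist (y i) (x i) < r := lt_of_le_of_lt (dist_le_pi_dist y x i) hy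
    rw [dist_eq_norm] at hyi
    have hc : |(y i) j - (x i) j| < r := by
      have h1 := PiLp.norm_apply_le (y i - x i) j
      rw [Real.norm_eq_abs] at h1
      have h2 : (y i - x i) j = (y i) j - (x i) j := rfl
      rw [h2] at h1
      linarith
    rw [abs_lt] at hc
    constructor
    · exact Int.floor_mono ((div_le_div_iff_of_pos_right hδ).2 (by linarith))
    · exact (Int.floor_mono ((div_le_div_iff_of_pos_right hδ).2 (by linarith))).trans
        (Int.floor_le_ceil _)
  -- values on the ball lie in a finite set of reals
  have hvals : ∀ y ∈ Metric.ball x r,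
      rescaledCorrelator G ρ n δ y ∈ (fun k => ρ δ ^ n * G n k) '' K := by
    intro y hy
    exact ⟨_, hmem y hy, rfl⟩
  obtain ⟨B, hB⟩ := ((hKfin.image fun k => ρ δ ^ n * G n k).image fun v => |v|).bddAbove
  refine ⟨B, fun y hy => hB ⟨_, hvals y hy, rfl⟩⟩

/-- **Pointwise scaling limits of lattice families are locally bounded** off the coincident locus. -/
theorem exists_local_bound_of_hasPointwiseScalingLimit (hlim : HasPointwiseScalingLimit G ρ S) (n : ℕ)
    {x : Fin n → EuclideanSpace ℝ (Fin 3)} (hx : x ∈ NonCoincident 3 n) :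
    ∃ t ∈ 𝓝[NonCoincident 3 n] x, ∃ B : ℝ, 0 < B ∧ ∀ y ∈ t, |S n y| ≤ B := by
  obtain ⟨t₁, ht₁, hev⟩ := Metric.tendstoLocallyUniformlyOn_iff.1 (hlim n) 1 one_pos x hx
  have hpos : ∀ᶠ δ : ℝ in 𝓝[>] 0, 0 < δ := eventually_mem_nhdsWithin
  obtain ⟨δ₀, hclose, hδ₀⟩ := (hev.and hpos).exists
  obtain ⟨B₀, hB₀⟩ := rescaledCorrelator_bounded_on_ball G ρ n hδ₀ x 1
  refine ⟨t₁ ∩ Metric.ball x 1, inter_mem ht₁ (mem_nhdsWithin_of_mem_nhds (Metric.ball_mem_nhds x one_pos)),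
    |B₀| + 1, by positivity, fun y hy => ?_⟩
  have h1 := hclose y hy.1
  have h2 := hB₀ y hy.2
  rw [Real.dist_eq] at h1
  have h3 : |S n y| ≤ |S n y - rescaledCorrelator G ρ n δ₀ y| + |rescaledCorrelator G ρ n δ₀ y| := by
    have := abs_add_le (S n y - rescaledCorrelator G ρ n δ₀ y) (rescaledCorrelator G ρ n δ₀ y)
    rwa [sub_add_cancel] at this
  linarith [le_abs_self B₀]

/-- Changing the renormalisation: `ρ'^n G = (ρ'/ρ)^n · (ρ^n G)`. -/
theorem rescaledCorrelator_change (G : LatticeCorrFamily 3) {ρ ρ' : ℝ → ℝ} (n : ℕ) {δ : ℝ}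
    (hρ : ρ δ ≠ 0) (y : Fin n → EuclideanSpace ℝ (Fin 3)) :
    rescaledCorrelator G ρ' n δ y = (ρ' δ / ρ δ) ^ n * rescaledCorrelator G ρ n δ y := by
  rw [rescaledCorrelator_apply, rescaledCorrelator_apply, ← mul_assoc, div_pow,
    div_mul_cancel₀ _ (pow_ne_zero n hρ)]

/-- **Stability of pointwise scaling limits under renormalisations with a convergent ratio** (model-blind,
every lattice family): if `ρ^n G_n([·/δ]) → S_n` locally uniformly off the diagonals and `ρ'/ρ → μ`, then
`ρ'^n G_n([·/δ]) → μ^n S_n` locally uniformly off the diagonals. -/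
theorem hasPointwiseScalingLimit_of_ratio_tendsto {μ : ℝ} (hlim : HasPointwiseScalingLimit G ρ S)
    (hρ : ∀ δ ∈ Set.Ioc (0 : ℝ) 1, ρ δ ≠ 0)
    (hq : Tendsto (fun δ => ρ' δ / ρ δ) (𝓝[>] 0) (𝓝 μ)) :
    HasPointwiseScalingLimit G ρ' (fun n x => μ ^ n * S n x) := by
  intro n
  rw [Metric.tendstoLocallyUniformlyOn_iff]
  intro ε hε x hx
  obtain ⟨t₀, ht₀, B, hB, hbound⟩ := exists_local_bound_of_hasPointwiseScalingLimit hlim n hx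
  set M : ℝ := |μ ^ n| + 1 with hM
  have hMpos : 0 < M := by positivity
  obtain ⟨t₁, ht₁, hev₁⟩ :=
    Metric.tendstoLocallyUniformlyOn_iff.1 (hlim n) (ε / (2 * M)) (by positivity) x hx
  have hqn : Tendsto (fun δ => (ρ' δ / ρ δ) ^ n) (𝓝[>] 0) (𝓝 (μ ^ n)) := hq.pow n
  have hev₂ : ∀ᶠ δ in 𝓝[>] (0 : ℝ), |(ρ' δ / ρ δ) ^ n - μ ^ n| < ε / (2 * B) := by
    have h := Metric.tendsto_nhds.1 hqn (ε / (2 * B)) (by positivity)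
    simpa [Real.dist_eq] using h
  have hev₃ : ∀ᶠ δ in 𝓝[>] (0 : ℝ), |(ρ' δ / ρ δ) ^ n - μ ^ n| < 1 := by
    have h := Metric.tendsto_nhds.1 hqn 1 one_pos
    simpa [Real.dist_eq] using h
  have hIoc : ∀ᶠ δ : ℝ in 𝓝[>] 0, δ ∈ Set.Ioc (0 : ℝ) 1 := Ioc_mem_nhdsGT one_pos
  refine ⟨t₀ ∩ t₁, inter_mem ht₀ ht₁, ?_⟩
  filter_upwards [hev₁, hev₂, hev₃, hIoc] with δ h₁ h₂ h₃ hδ y hy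
  set q : ℝ := (ρ' δ / ρ δ) ^ n with hqdef
  set F : ℝ := rescaledCorrelator G ρ n δ y with hF
  set f : ℝ := S n y with hf
  have hq1 : |q| ≤ M := by
    have := abs_sub_abs_le_abs_sub q (μ ^ n)
    rw [hM]; linarith
  have hFf : |f - F| < ε / (2 * M) := by
    have := h₁ y hy.2; rwa [Real.dist_eq] at this
  have hfB : |f| ≤ B := hbound y hy.1
  rw [rescaledCorrelator_change G n (hρ δ hδ) y, Real.dist_eq]
  show |μ ^ n * f - q * F| < ε
  have key : μ ^ n * f - q * F = q * (f - F) - (q - μ ^ n) * f := by ring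
  rw [key]
  calc |q * (f - F) - (q - μ ^ n) * f|
      ≤ |q * (f - F)| + |(q - μ ^ n) * f| := abs_sub _ _
    _ = |q| * |f - F| + |q - μ ^ n| * |f| := by rw [abs_mul, abs_mul]
    _ ≤ M * |f - F| + |q - μ ^ n| * B := by
        gcongr
    _ < M * (ε / (2 * M)) + (ε / (2 * B)) * B := by
        gcongr
    _ = ε := by field_simp; ring

/-- Scalar multiples `κ^n S_n` of a Möbius-covariant family are Möbius covariant (same `Δ`). -/
theorem isMoebiusCovariant_const_pow_mul {Δ κ : ℝ} {S : CorrFamily 3} (h : IsMoebiusCovariant Δ S) :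
    IsMoebiusCovariant Δ (fun n x => κ ^ n * S n x) := by
  obtain ⟨⟨ht, hr⟩, hs, hi⟩ := h
  refine ⟨⟨fun n v x => ?_, fun n R x => ?_⟩, fun n c hc x => ?_, fun n x hx => ?_⟩
  · simp only [ht n v x]
  · simp only [hr n R x]
  · simp only [hs n c hc x]; ring
  · simp only [hi n x hx]; ring

/-- `[e₁/δ] = ⌊1/δ⌋ e₁` at every mesh. -/
theorem latticeApprox_unitVec (δ : ℝ) :
    latticeApprox δ (EuclideanSpace.single (0 : Fin 3) (1 : ℝ)) = Pi.single (0 : Fin 3) ⌊1 / δ⌋ := by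
  funext i
  rw [latticeApprox_apply, unitVec_apply]
  by_cases hi : i = 0
  · subst hi; rw [if_pos rfl, Pi.single_eq_same]
  · rw [if_neg hi, Pi.single_eq_of_ne hi, zero_div, Int.floor_zero]

/-- The rescaled critical two-point correlator at `(0, e₁)`, every mesh: `ρ(δ)² ⟨σ₀σ_{⌊1/δ⌋e₁}⟩_{β_c}`. -/
theorem rescaledCorrelator_criticalCorr_unitVec (ρ : ℝ → ℝ) (δ : ℝ) :
    rescaledCorrelator (criticalCorr 3) ρ 2 δ ![0, EuclideanSpace.single (0 : Fin 3) (1 : ℝ)] =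
      ρ δ ^ 2 * criticalTwoPoint 3 (Pi.single (0 : Fin 3) ⌊1 / δ⌋) := by
  rw [rescaledCorrelator_apply, ← criticalCorr_two]
  congr 1
  congr 1
  funext i
  fin_cases i
  · simp [latticeApprox_zero]
  · simpa using latticeApprox_unitVec δ

/-- `⌊1/δ⌋ → +∞` as `δ → 0⁺`. -/
theorem tendsto_floor_one_div : Tendsto (fun δ : ℝ => ⌊1 / δ⌋) (𝓝[>] (0 : ℝ)) atTop := by
  have h1 : Tendsto (fun δ : ℝ => 1 / δ) (𝓝[>] 0) atTop := by
    simpa only [one_div] using tendsto_inv_nhdsGT_zero (𝕜 := ℝ)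
  exact tendsto_floor_atTop.comp h1

/-- The two-point law read along `⌊1/δ⌋ e₁`: `G(⌊1/δ⌋e₁) ⌊1/δ⌋^{2Δ} → c` as `δ → 0⁺`. -/
theorem twoPointLaw_along_mesh {Δ c : ℝ}
    (hP : Tendsto (fun x : Site 3 =>
      criticalTwoPoint 3 x * Real.sqrt (∑ i, ((x i : ℝ)) ^ 2) ^ (2 * Δ)) cofinite (nhds c)) :
    Tendsto (fun δ : ℝ => criticalTwoPoint 3 (Pi.single (0 : Fin 3) ⌊1 / δ⌋) * ((⌊1 / δ⌋ : ℤ) : ℝ) ^ (2 * Δ))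
      (𝓝[>] (0 : ℝ)) (nhds c) := by
  have hinj : Function.Injective fun m : ℤ => (Pi.single (0 : Fin 3) m : Site 3) := fun a b h => by
    simpa using congrFun h 0
  have h := hP.comp (hinj.tendsto_cofinite.comp (tendsto_floor_one_div.mono_right atTop_le_cofinite))
  have hIoc : ∀ᶠ δ : ℝ in 𝓝[>] 0, δ ∈ Set.Ioc (0 : ℝ) 1 := Ioc_mem_nhdsGT one_pos
  refine h.congr' ?_
  filter_upwards [hIoc] with δ hδ
  simp only [Function.comp_apply]
  rw [sqrt_sum_sq_single_axis, abs_of_pos]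
  have h1 : (1 : ℤ) ≤ ⌊1 / δ⌋ := Int.le_floor.2 (by rw [Int.cast_one]; exact (one_le_div hδ.1).2 hδ.2)
  exact_mod_cast h1

/-- **The renormalisation along the full filter.** Under the two-point law `(Δ, c)`, every pointwise scaling
limit `(ρ, S)` of `criticalCorr 3` has `ρ(δ)² δ^{2Δ} → S₂(0,e₁)/c` as `δ → 0⁺` (cycle 1 / p68682 had the
dyadic subsequence `δ_k = 2^{-(k+1)}`; here the whole filter, via `δ⌊1/δ⌋ → 1`). -/
theorem tendsto_rho_sq_mul_rpow {Δ c : ℝ} (hc : 0 < c)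
    (hP : Tendsto (fun x : Site 3 =>
      criticalTwoPoint 3 x * Real.sqrt (∑ i, ((x i : ℝ)) ^ 2) ^ (2 * Δ)) cofinite (nhds c))
    {ρ : ℝ → ℝ} {S : CorrFamily 3} (hlim : HasPointwiseScalingLimit (criticalCorr 3) ρ S) :
    Tendsto (fun δ : ℝ => ρ δ ^ 2 * δ ^ (2 * Δ)) (𝓝[>] (0 : ℝ))
      (nhds (S 2 ![0, EuclideanSpace.single (0 : Fin 3) (1 : ℝ)] / c)) := by
  set s₁ := S 2 ![0, EuclideanSpace.single (0 : Fin 3) (1 : ℝ)] with hs₁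
  -- (A) ρ² G(m e₁) → s₁, m = ⌊1/δ⌋
  have hA : Tendsto (fun δ => ρ δ ^ 2 * criticalTwoPoint 3 (Pi.single (0 : Fin 3) ⌊1 / δ⌋)) (𝓝[>] 0)
      (nhds s₁) := by
    have h := (hlim 2).tendsto_at (zero_unitVec_mem_nonCoincident (t := (1 : ℝ)) one_ne_zero)
    refine h.congr fun δ => ?_
    exact rescaledCorrelator_criticalCorr_unitVec ρ δ
  -- (B) G(m e₁) m^{2Δ} → c
  have hB := twoPointLaw_along_mesh hP
  -- (C) (δ m)^{2Δ} → 1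
  have hC : Tendsto (fun δ : ℝ => (δ * ((⌊1 / δ⌋ : ℤ) : ℝ)) ^ (2 * Δ)) (𝓝[>] 0) (nhds 1) := by
    have h := (Literature.Barriers.CriticalPhenomena.ScaleNotMoebius.tendsto_mesh_mul_floor (1 : ℝ)).rpow_const
      (p := 2 * Δ) (Or.inl one_ne_zero)
    rw [Real.one_rpow] at h
    exact h
  have hBne : ∀ᶠ δ in 𝓝[>] (0 : ℝ),
      criticalTwoPoint 3 (Pi.single (0 : Fin 3) ⌊1 / δ⌋) * ((⌊1 / δ⌋ : ℤ) : ℝ) ^ (2 * Δ) ≠ 0 :=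
    hB.eventually_ne hc.ne'
  have hIoc : ∀ᶠ δ : ℝ in 𝓝[>] 0, δ ∈ Set.Ioc (0 : ℝ) 1 := Ioc_mem_nhdsGT one_pos
  have hlimit := (hA.div hB hc.ne').mul hC
  rw [mul_one] at hlimit
  refine hlimit.congr' ?_
  filter_upwards [hBne, hIoc] with δ hne hδ
  have hmpos : (0 : ℝ) < ((⌊1 / δ⌋ : ℤ) : ℝ) := by
    have h1 : (1 : ℤ) ≤ ⌊1 / δ⌋ := Int.le_floor.2 (by rw [Int.cast_one]; exact (one_le_div hδ.1).2 hδ.2)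
    exact_mod_cast h1
  have hGne : criticalTwoPoint 3 (Pi.single (0 : Fin 3) ⌊1 / δ⌋) ≠ 0 := fun h0 => hne (by rw [h0, zero_mul])
  have hmne : ((⌊1 / δ⌋ : ℤ) : ℝ) ^ (2 * Δ) ≠ 0 := (Real.rpow_pos_of_pos hmpos _).ne'
  simp only [Pi.div_apply]
  rw [Real.mul_rpow hδ.1.le hmpos.le]
  field_simp

/-- Hence the canonical ratio converges: `δ^{-Δ}/ρ(δ) → √(c/S₂(0,e₁))`. -/
theorem tendsto_canonical_ratio {Δ c : ℝ} (hc : 0 < c)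
    (hP : Tendsto (fun x : Site 3 =>
      criticalTwoPoint 3 x * Real.sqrt (∑ i, ((x i : ℝ)) ^ 2) ^ (2 * Δ)) cofinite (nhds c))
    {ρ : ℝ → ℝ} {S : CorrFamily 3} (hρ : ∀ δ ∈ Set.Ioc (0 : ℝ) 1, 0 < ρ δ)
    (hlim : HasPointwiseScalingLimit (criticalCorr 3) ρ S) (hnd : IsNondegenerateTwoPoint S) :
    Tendsto (fun δ : ℝ => δ ^ (-Δ) / ρ δ) (𝓝[>] (0 : ℝ))
      (nhds (Real.sqrt (c / S 2 ![0, EuclideanSpace.single (0 : Fin 3) (1 : ℝ)]))) := by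
  set s₁ := S 2 ![0, EuclideanSpace.single (0 : Fin 3) (1 : ℝ)] with hs₁
  have hs₁pos : 0 < s₁ := hnd _ (zero_unitVec_mem_nonCoincident one_ne_zero)
  have h := tendsto_rho_sq_mul_rpow hc hP hlim
  have hinv : Tendsto (fun δ : ℝ => (ρ δ ^ 2 * δ ^ (2 * Δ))⁻¹) (𝓝[>] 0) (nhds (c / s₁)) := by
    have := h.inv₀ (div_pos hs₁pos hc).ne'
    simpa [inv_div] using this
  have hIoc : ∀ᶠ δ : ℝ in 𝓝[>] 0, δ ∈ Set.Ioc (0 : ℝ) 1 := Ioc_mem_nhdsGT one_pos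
  have hsq : Tendsto (fun δ : ℝ => (δ ^ (-Δ) / ρ δ) ^ 2) (𝓝[>] 0) (nhds (c / s₁)) := by
    refine hinv.congr' ?_
    filter_upwards [hIoc] with δ hδ
    have hρne : ρ δ ≠ 0 := (hρ δ hδ).ne'
    rw [div_pow, Real.rpow_neg hδ.1.le, inv_pow, ← Real.rpow_mul_natCast hδ.1.le,
      show Δ * ((2 : ℕ) : ℝ) = 2 * Δ by push_cast; ring, mul_comm (ρ δ ^ 2), mul_inv, div_eq_mul_inv]
  refine hsq.sqrt.congr' ?_
  filter_upwards [hIoc] with δ hδ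
  exact Real.sqrt_sq (div_pos (Real.rpow_pos_of_pos hδ.1 _) (hρ δ hδ)).le

end Canonical

section CanonicalForm


/-- **Canonical form of the crux.** `MoebiusLimitOfTwoPointLaw` holds iff for every `(Δ, c)` witnessing the
two-point law, the canonical statement holds: the quantifiers `∃ ρ ∃ Δ'` of item 1344 carry no freedom under
item 0634 (`Δ' = Δ` by p68682; `ρ ~ κ δ^{-Δ}` by `tendsto_canonical_ratio`; renormalisations with convergent
ratio are interchangeable by `hasPointwiseScalingLimit_of_ratio_tendsto`). What a prover must produce is
therefore exactly: convergence of `δ^{-nΔ}⟨σ_{[x₁/δ]}⋯σ_{[xₙ/δ]}⟩_{β_c}` for all `n` along the full filter, and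
Möbius covariance of the limit with the two-point exponent `Δ`. -/
theorem moebiusLimitOfTwoPointLaw_iff_canonical :
    MoebiusLimitOfTwoPointLaw ↔
      ∀ Δ c : ℝ, 0 < c →
        Tendsto (fun x : Site 3 =>
          criticalTwoPoint 3 x * Real.sqrt (∑ i, ((x i : ℝ)) ^ 2) ^ (2 * Δ)) cofinite (nhds c) →
        ∃ S : CorrFamily 3, HasPointwiseScalingLimit (criticalCorr 3) (fun δ => δ ^ (-Δ)) S ∧
          IsNondegenerateTwoPoint S ∧ IsMoebiusCovariant Δ S := by
  constructor
  · intro h Δ c hc hP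
    obtain ⟨ρ, Δ', S, hρ, -, hlim, hnd, hM⟩ := h ⟨Δ, c, hc, hP⟩
    obtain ⟨hΔ, -⟩ := moebius_scalingDimension_eq_of_twoPointLaw hc hP hρ hlim hnd hM
    subst hΔ
    set μ : ℝ := Real.sqrt (c / S 2 ![0, EuclideanSpace.single (0 : Fin 3) (1 : ℝ)]) with hμ
    have hs : 0 < S 2 ![0, EuclideanSpace.single (0 : Fin 3) (1 : ℝ)] :=
      hnd _ (zero_unitVec_mem_nonCoincident one_ne_zero)
    have hμpos : 0 < μ := Real.sqrt_pos.2 (div_pos hc hs)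
    refine ⟨fun n x => μ ^ n * S n x, ?_, ?_, isMoebiusCovariant_const_pow_mul hM⟩
    · exact hasPointwiseScalingLimit_of_ratio_tendsto hlim (fun δ hδ => (hρ δ hδ).ne')
        (tendsto_canonical_ratio hc hP hρ hlim hnd)
    · intro x hx
      exact mul_pos (pow_pos hμpos 2) (hnd x hx)
  · rintro h ⟨Δ, c, hc, hP⟩
    obtain ⟨S, hlim, hnd, hM⟩ := h Δ c hc hP
    exact ⟨fun δ => δ ^ (-Δ), Δ, S, fun δ hδ => Real.rpow_pos_of_pos hδ.1 _,
      twoPointLaw_exponent_pos hc hP, hlim, hnd, hM⟩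

/-- One-exponent reading: if `(Δ, c)` witnesses `P`, the crux is equivalent to the canonical statement at `Δ`
(for THAT `Δ`; any other witness `(Δ₂, c₂)` of `P` has `Δ₂ = Δ`, next lemma). -/
theorem moebiusLimitOfTwoPointLaw_iff_canonical_at {Δ c : ℝ} (hc : 0 < c)
    (hP : Tendsto (fun x : Site 3 =>
      criticalTwoPoint 3 x * Real.sqrt (∑ i, ((x i : ℝ)) ^ 2) ^ (2 * Δ)) cofinite (nhds c)) :
    MoebiusLimitOfTwoPointLaw ↔
      ∃ S : CorrFamily 3, HasPointwiseScalingLimit (criticalCorr 3) (fun δ => δ ^ (-Δ)) S ∧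
        IsNondegenerateTwoPoint S ∧ IsMoebiusCovariant Δ S := by
  rw [moebiusLimitOfTwoPointLaw_iff_canonical]
  constructor
  · exact fun h => h Δ c hc hP
  · intro h Δ₂ c₂ hc₂ hP₂
    have heq : Δ₂ = Δ := twoPointLaw_exponent_unique hc₂ hP₂ hc hP
    subst heq
    exact h
  where
  /-- Two witnesses of `P` have the same exponent (and then the same constant). -/
  twoPointLaw_exponent_unique {Δ₁ c₁ Δ₂ c₂ : ℝ} (hc₁ : 0 < c₁)
      (h₁ : Tendsto (fun x : Site 3 =>
        criticalTwoPoint 3 x * Real.sqrt (∑ i, ((x i : ℝ)) ^ 2) ^ (2 * Δ₁)) cofinite (nhds c₁))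
      (hc₂ : 0 < c₂)
      (h₂ : Tendsto (fun x : Site 3 =>
        criticalTwoPoint 3 x * Real.sqrt (∑ i, ((x i : ℝ)) ^ 2) ^ (2 * Δ₂)) cofinite (nhds c₂)) :
      Δ₁ = Δ₂ := by
    -- along `n e₁`: G n^{2Δ₁} → c₁ and G n^{2Δ₂} → c₂ force n^{2(Δ₁-Δ₂)} → c₁/c₂ ∈ (0,∞), so Δ₁ = Δ₂
    have g₁ : Tendsto (fun n : ℕ => criticalTwoPoint 3 (Pi.single 0 ((n + 1 : ℕ) : ℤ)) *
        ((n + 1 : ℕ) : ℝ) ^ (2 * Δ₁)) atTop (nhds c₁) := by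
      refine (h₁.comp (tendsto_natCast_single_axis_cofinite.comp (tendsto_add_atTop_nat 1))).congr
        fun n => ?_
      simp only [Function.comp_apply]
      rw [sqrt_sum_sq_single_axis, Int.cast_natCast, abs_of_nonneg (Nat.cast_nonneg _)]
    have g₂ : Tendsto (fun n : ℕ => criticalTwoPoint 3 (Pi.single 0 ((n + 1 : ℕ) : ℤ)) *
        ((n + 1 : ℕ) : ℝ) ^ (2 * Δ₂)) atTop (nhds c₂) := by
      refine (h₂.comp (tendsto_natCast_single_axis_cofinite.comp (tendsto_add_atTop_nat 1))).congr
        fun n => ?_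
      simp only [Function.comp_apply]
      rw [sqrt_sum_sq_single_axis, Int.cast_natCast, abs_of_nonneg (Nat.cast_nonneg _)]
    have hratio : Tendsto (fun n : ℕ => ((n + 1 : ℕ) : ℝ) ^ (2 * Δ₁ - 2 * Δ₂)) atTop (nhds (c₁ / c₂)) := by
      have hne : ∀ᶠ n : ℕ in atTop, criticalTwoPoint 3 (Pi.single 0 ((n + 1 : ℕ) : ℤ)) *
          ((n + 1 : ℕ) : ℝ) ^ (2 * Δ₂) ≠ 0 := g₂.eventually_ne hc₂.ne'
      refine (g₁.div g₂ hc₂.ne').congr' ?_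
      filter_upwards [hne] with n hn
      have hpos : (0 : ℝ) < ((n + 1 : ℕ) : ℝ) := by positivity
      have hG : criticalTwoPoint 3 (Pi.single 0 ((n + 1 : ℕ) : ℤ)) ≠ 0 := fun h0 => hn (by rw [h0, zero_mul])
      simp only [Pi.div_apply]
      rw [Real.rpow_sub hpos, mul_div_mul_left _ _ hG]
    have hcast : Tendsto (fun n : ℕ => ((n + 1 : ℕ) : ℝ)) atTop atTop :=
      tendsto_natCast_atTop_atTop.comp (tendsto_add_atTop_nat 1)
    rcases lt_trichotomy (2 * Δ₁ - 2 * Δ₂) 0 with hlt | heq | hgt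
    · exfalso
      have h0 : Tendsto (fun n : ℕ => ((n + 1 : ℕ) : ℝ) ^ (2 * Δ₁ - 2 * Δ₂)) atTop (nhds 0) := by
        have := (tendsto_rpow_neg_atTop (y := -(2 * Δ₁ - 2 * Δ₂)) (by linarith)).comp hcast
        refine this.congr fun n => ?_
        simp
      have := tendsto_nhds_unique hratio h0
      exact (div_pos hc₁ hc₂).ne' this
    · linarith
    · exfalso
      have hinf : Tendsto (fun n : ℕ => ((n + 1 : ℕ) : ℝ) ^ (2 * Δ₁ - 2 * Δ₂)) atTop atTop :=
        (tendsto_rpow_atTop hgt).comp hcast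
      exact hratio.not_tendsto (disjoint_nhds_atTop _) hinf

end CanonicalForm


end Summit.CriticalPhenomena.Ising3DConformalLimit.Theorems.MoebiusLimitOfTwoPointLaw.Negative

end
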